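import Summits.AtomisticToContinuum.HydrodynamicLimit.Theorems.InformationPercolationEngineChaosClosesEulerStressIsotropyB
import HarnessLib

/-!
# Weak stress isotropy in band (crux `ChaosClosesEuler`, stmt-AtomisticToContinuum-15141, line `Sketch`,
# stub `stub_stressIsotropyOfLocalEquilibrium`) — helper C: the bulk identity

WHAT. On the bulk (`ρ_r > 0`, `θ_r > 0`) the traceless contraction of the central second-moment tensor
`P_{jk} = M_{jk} − mⱼmₖ/ρ_r` is, up to velocity tails, a sum of POINTWISE-LOCAL-EQUILIBRIUM errors: the velocity
cut-off `phiCut L v = clamp01 (L + 1 − ‖v‖)` and the bounded continuous tests `psiJK L j k v = vⱼvₖ φ_L(v)`,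
`psiE L v = ‖v‖² φ_L(v)`; `maxwellian_trunc_le` (from `MaxwellianMoments`, a hypothesis VERBATIM the skeleton's):
`|(uⱼuₖ + θδⱼₖ) − ∫ψ_{jk} M_{1,θ,u}| ≤ (‖u‖² + 3θ) − ∫ψ_E M_{1,θ,u}`; `abs_sum_Pm_le_of_bulk`: for a traceless `a` with
`|a_{jk}| ≤ A`, `|Σ a_{jk} P_{jk}| ≤ A Σ_{jk} |err_{jk}| + 9A (|err_E| + 2 MpsiC (sqTail L))`,
`err_ψ = MpsiC ψ − ρ_r ∫ ψ M_{1,θ_r,u_r}` (tracelessness kills `ρ_rθ_r tr a`, `mⱼmₖ/ρ_r = ρ_r uⱼuₖ`, and the Maxwellian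
energy tail is `2e_r − ρ_r∫ψ_E M ≤ |err_E| + tail` by `ρ_r(‖u_r‖² + 3θ_r) = 2e_r`); `abs_weighted_sum_Pm_le`: the
pointwise bound of the integrand of `WeakStressIsotropyInBand` (non-bulk part by helper B, bulk part by the above
with the weight `h = χ · g(σ³ρ)`).  No named fact is invoked.
-/

noncomputable section

namespace Summit.AtomisticToContinuum.HydrodynamicLimit.Theorems.ChaosClosesEulerStressIsotropy

open scoped BigOperators Topology Classical MeasureTheory ENNReal InnerProductSpace
open Filter Set MeasureTheory Function
open Literature.MathematicalPhysics.KineticTheory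
open Literature.Analysis.FluidPDE
open Literature.Analysis.FunctionSpaces
open Summit.AtomisticToContinuum.HydrodynamicLimit.Theorems.LocalSecondLawNegative
open Summit.AtomisticToContinuum.HydrodynamicLimit.Theorems.LocalSecondLawLedger
open Summit.AtomisticToContinuum.HydrodynamicLimit.Theorems.LocalSecondLawLedger.L
  (Mmom rhoC_eq_sum momC_apply_eq_sum momC_eq_sum uC_apply norm_sq_eq_sum)
open Summit.AtomisticToContinuum.HydrodynamicLimit.Theorems.ChaosClosesEulerReduction

variable {N : ℕ}

/-! ## §1 The velocity cut-off and the truncated tests -/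

/-- The velocity cut-off `φ_L(v) = clamp01 (L + 1 − ‖v‖)`: `1` on `‖v‖ ≤ L`, `0` on `‖v‖ ≥ L + 1`. [folklore] -/
def phiCut (L : ℝ) (v : V3) : ℝ := clamp01 (L + 1 - ‖v‖)

/-- `0 ≤ φ_L`. [folklore] -/
theorem phiCut_nonneg (L : ℝ) (v : V3) : 0 ≤ phiCut L v := clamp01_nonneg _
/-- `φ_L ≤ 1`. [folklore] -/
theorem phiCut_le_one (L : ℝ) (v : V3) : phiCut L v ≤ 1 := clamp01_le_one _
/-- `φ_L = 1` on the ball of radius `L`. [folklore] -/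
theorem phiCut_eq_one {L : ℝ} {v : V3} (h : ‖v‖ ≤ L) : phiCut L v = 1 := clamp01_of_one_le (by linarith)

/-- `φ_L = 0` off the ball of radius `L + 1`. [folklore] -/
theorem phiCut_eq_zero {L : ℝ} {v : V3} (h : L + 1 ≤ ‖v‖) : phiCut L v = 0 := clamp01_of_nonpos (by linarith)

/-- `φ_L` is continuous. [folklore] -/
theorem continuous_phiCut (L : ℝ) : Continuous (phiCut L) :=
  continuous_clamp01.comp (continuous_const.sub continuous_norm)

/-- The soft energy tail is below the hard one: `‖v‖²(1 − φ_L) ≤ sqTail L`. [folklore] -/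
theorem norm_sq_mul_one_sub_phiCut_le (L : ℝ) (v : V3) : ‖v‖ ^ 2 * (1 - phiCut L v) ≤ sqTail L v :=
  norm_sq_mul_le_sqTail (by linarith [phiCut_nonneg L v]) fun h => by rw [phiCut_eq_one h, sub_self]

/-- The truncated stress test `ψ_{jk}(v) = vⱼ vₖ φ_L(v)`. [folklore] -/
def psiJK (L : ℝ) (j k : Fin 3) (v : V3) : ℝ := v j * v k * phiCut L v

/-- The truncated energy test `ψ_E(v) = ‖v‖² φ_L(v)`. [folklore] -/
def psiE (L : ℝ) (v : V3) : ℝ := ‖v‖ ^ 2 * phiCut L v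

/-- `ψ_{jk}` is continuous. [folklore] -/
theorem continuous_psiJK (L : ℝ) (j k : Fin 3) : Continuous (psiJK L j k) := by
  unfold psiJK
  exact (((EuclideanSpace.proj j : V3 →L[ℝ] ℝ).continuous).mul
    ((EuclideanSpace.proj k : V3 →L[ℝ] ℝ).continuous)).mul (continuous_phiCut L)

/-- `ψ_E` is continuous. [folklore] -/
theorem continuous_psiE (L : ℝ) : Continuous (psiE L) := by
  unfold psiE
  exact (continuous_norm.pow 2).mul (continuous_phiCut L)

/-- `‖v‖² φ_L(v) ≤ (L+1)²`. [folklore] -/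
theorem norm_sq_mul_phiCut_le (L : ℝ) (v : V3) : ‖v‖ ^ 2 * phiCut L v ≤ (L + 1) ^ 2 := by
  by_cases h : L + 1 ≤ ‖v‖
  · rw [phiCut_eq_zero h, mul_zero]; positivity
  · rw [not_le] at h
    calc ‖v‖ ^ 2 * phiCut L v ≤ ‖v‖ ^ 2 * 1 := mul_le_mul_of_nonneg_left (phiCut_le_one L v) (by positivity)
      _ ≤ (L + 1) ^ 2 := by rw [mul_one]; exact pow_le_pow_left₀ (norm_nonneg _) h.le 2

/-- `|ψ_{jk}| ≤ (L+1)²`. [folklore] -/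
theorem abs_psiJK_le (L : ℝ) (j k : Fin 3) (v : V3) : |psiJK L j k v| ≤ (L + 1) ^ 2 := by
  unfold psiJK
  rw [abs_mul, abs_of_nonneg (phiCut_nonneg L v)]
  exact (mul_le_mul_of_nonneg_right (abs_apply_mul_apply_le v j k) (phiCut_nonneg L v)).trans
    (norm_sq_mul_phiCut_le L v)

/-- `|ψ_E| ≤ (L+1)²`. [folklore] -/
theorem abs_psiE_le (L : ℝ) (v : V3) : |psiE L v| ≤ (L + 1) ^ 2 := by
  unfold psiE
  rw [abs_of_nonneg (mul_nonneg (by positivity) (phiCut_nonneg L v))]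
  exact norm_sq_mul_phiCut_le L v

/-! ## §2 The Maxwellian side: truncated second moments from `MaxwellianMoments` -/

/-- **Truncation of the Maxwellian second moments** (from `MaxwellianMoments`, `θ > 0`):
`|(uⱼuₖ + θδⱼₖ) − ∫ψ_{jk} M_{1,θ,u}| ≤ (‖u‖² + 3θ) − ∫ψ_E M_{1,θ,u}`. [folklore] -/
theorem maxwellian_trunc_le
    (hMM : ∀ (ρ θ : ℝ) (u : V3), 0 < ρ → 0 < θ →
      let m : Measure V3 := volume.withDensity (fun v => ENNReal.ofReal (localMaxwellian ρ θ u v))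
      IsFiniteMeasure m ∧ Integrable (fun v : V3 => ‖v‖ ^ 2) m ∧
      (m Set.univ).toReal = ρ ∧ (∀ j : Fin 3, ∫ v, v j ∂m = ρ * u j) ∧
      (∀ j k : Fin 3, ∫ v, v j * v k ∂m = ρ * (u j * u k + if j = k then θ else 0)) ∧
      (∫ v, ‖v‖ ^ 2 ∂m = ρ * (‖u‖ ^ 2 + 3 * θ)) ∧
      (∀ ψ : V3 → ℝ, Continuous ψ → (∃ C : ℝ, ∀ v, |ψ v| ≤ C) →
        Integrable ψ m ∧ ∫ v, ψ v ∂m = ρ * ∫ v, ψ v * localMaxwellian 1 θ u v))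
    {θ : ℝ} (hθ : 0 < θ) (u : V3) (L : ℝ) (j k : Fin 3) :
    |(u j * u k + if j = k then θ else 0) - ∫ v, psiJK L j k v * localMaxwellian 1 θ u v| ≤
      (‖u‖ ^ 2 + 3 * θ) - ∫ v, psiE L v * localMaxwellian 1 θ u v := by
  obtain ⟨-, hint2, -, -, hstress, hen, hψ⟩ := hMM 1 θ u one_pos hθ
  set m : Measure V3 := volume.withDensity (fun v => ENNReal.ofReal (localMaxwellian 1 θ u v)) with hm
  obtain ⟨hiJK, hJK⟩ := hψ (psiJK L j k) (continuous_psiJK L j k) ⟨(L + 1) ^ 2, abs_psiJK_le L j k⟩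
  obtain ⟨hiE, hE⟩ := hψ (psiE L) (continuous_psiE L) ⟨(L + 1) ^ 2, abs_psiE_le L⟩
  have hs := hstress j k
  rw [one_mul] at hJK hE hs hen
  have hc1 : Continuous fun v : V3 => v j * v k :=
    ((EuclideanSpace.proj j : V3 →L[ℝ] ℝ).continuous).mul ((EuclideanSpace.proj k : V3 →L[ℝ] ℝ).continuous)
  have h1φ : ∀ v : V3, 0 ≤ 1 - phiCut L v := fun v => sub_nonneg.2 (phiCut_le_one L v)
  have h1φ' : ∀ v : V3, 1 - phiCut L v ≤ 1 := fun v => by linarith [phiCut_nonneg L v]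
  have hiVV : Integrable (fun v : V3 => v j * v k) m :=
    hint2.mono' hc1.aestronglyMeasurable (ae_of_all _ fun v => by
      rw [Real.norm_eq_abs]; exact abs_apply_mul_apply_le v j k)
  have hbd : ∀ v : V3, |v j * v k * (1 - phiCut L v)| ≤ ‖v‖ ^ 2 * (1 - phiCut L v) := fun v => by
    rw [abs_mul, abs_of_nonneg (h1φ v)]
    exact mul_le_mul_of_nonneg_right (abs_apply_mul_apply_le v j k) (h1φ v)
  have hbd2 : ∀ v : V3, ‖v‖ ^ 2 * (1 - phiCut L v) ≤ ‖v‖ ^ 2 := fun v =>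
    (mul_le_mul_of_nonneg_left (h1φ' v) (by positivity)).trans (mul_one _).le
  have hiR2 : Integrable (fun v : V3 => ‖v‖ ^ 2 * (1 - phiCut L v)) m :=
    hint2.mono' ((continuous_norm.pow 2).mul (continuous_const.sub (continuous_phiCut L))).aestronglyMeasurable
      (ae_of_all _ fun v => by
        rw [Real.norm_eq_abs, abs_of_nonneg (mul_nonneg (by positivity) (h1φ v))]; exact hbd2 v)
  have e1 : (u j * u k + if j = k then θ else 0) - ∫ v, psiJK L j k v * localMaxwellian 1 θ u v =
      ∫ v, v j * v k * (1 - phiCut L v) ∂m := by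
    rw [← hs, ← hJK, ← integral_sub hiVV hiJK]
    congr 1; funext v; unfold psiJK; ring
  have e2 : (‖u‖ ^ 2 + 3 * θ) - ∫ v, psiE L v * localMaxwellian 1 θ u v = ∫ v, ‖v‖ ^ 2 * (1 - phiCut L v) ∂m := by
    rw [← hen, ← hE, ← integral_sub hint2 hiE]
    congr 1; funext v; unfold psiE; ring
  rw [e1, e2]
  have h := norm_integral_le_of_norm_le (μ := m) (f := fun v : V3 => v j * v k * (1 - phiCut L v)) hiR2
    (ae_of_all _ fun v => by rw [Real.norm_eq_abs]; exact hbd v)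
  rwa [Real.norm_eq_abs] at h

/-! ## §3 The empirical side: truncation costs a tail -/

/-- `|MpsiC (vⱼvₖ) − MpsiC ψ_{jk}| ≤ MpsiC (sqTail L)`. [folklore] -/
theorem abs_MpsiC_vv_sub_le {r : ℝ} (hr : 0 < r) (w : Phase N) (x : T3) (L : ℝ) (j k : Fin 3) :
    |MpsiC r w x (fun v => v j * v k) - MpsiC r w x (psiJK L j k)| ≤ MpsiC r w x (sqTail L) := by
  rw [← MpsiC_sub]
  refine abs_MpsiC_le hr w x fun v => ?_
  have h1 : v j * v k - psiJK L j k v = v j * v k * (1 - phiCut L v) := by unfold psiJK; ring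
  rw [h1, abs_mul, abs_of_nonneg (sub_nonneg.2 (phiCut_le_one L v))]
  exact (mul_le_mul_of_nonneg_right (abs_apply_mul_apply_le v j k) (sub_nonneg.2 (phiCut_le_one L v))).trans
    (norm_sq_mul_one_sub_phiCut_le L v)

/-- `2e_r − MpsiC ψ_E ≤ MpsiC (sqTail L)`. [folklore] -/
theorem two_kinC_sub_MpsiC_psiE_le {r : ℝ} (hr : 0 < r) (w : Phase N) (x : T3) (L : ℝ) :
    2 * kinC r w x - MpsiC r w x (psiE L) ≤ MpsiC r w x (sqTail L) := by
  rw [two_mul_kinC_eq_MpsiC, ← MpsiC_sub]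
  refine MpsiC_mono hr w x fun v => ?_
  have h1 : ‖v‖ ^ 2 - psiE L v = ‖v‖ ^ 2 * (1 - phiCut L v) := by unfold psiE; ring
  rw [h1]
  exact norm_sq_mul_one_sub_phiCut_le L v

/-! ## §4 The bulk identity -/

/-- Contraction with the identity: `Σ_{jk} a_{jk} (c δ_{jk}) = c tr a`. [folklore] -/
theorem sum_sum_mul_ite (a : Fin 3 → Fin 3 → ℝ) (c : ℝ) :
    ∑ j, ∑ k, a j k * (if j = k then c else 0) = c * ∑ j, a j j := by
  rw [Finset.mul_sum]
  refine Finset.sum_congr rfl fun j _ => ?_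
  rw [Finset.sum_eq_single j (fun k _ hkj => by rw [if_neg (Ne.symm hkj), mul_zero])
    (fun h => absurd (Finset.mem_univ j) h), if_pos rfl, mul_comm]

/-- **Tracelessness removes the pressure**: off the empty cone, for a traceless `a`,
`Σ a_{jk} P_{jk} = Σ a_{jk} (MpsiC(vⱼvₖ) − ρ_r(uⱼuₖ + θ_r δ_{jk}))`. [folklore] -/
theorem sum_mul_Pm_eq {r : ℝ} {w : Phase N} {x : T3} (hρ : rhoC r w x ≠ 0) (a : Fin 3 → Fin 3 → ℝ)
    (htr : ∑ j, a j j = 0) :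
    ∑ j, ∑ k, a j k * (Mmom r w x j k - momC r w x j * momC r w x k / rhoC r w x) =
      ∑ j, ∑ k, a j k * (MpsiC r w x (fun v => v j * v k) -
        rhoC r w x * (uC r w x j * uC r w x k + if j = k then thetaC r w x else 0)) := by
  have h1 : ∀ j k, a j k * (Mmom r w x j k - momC r w x j * momC r w x k / rhoC r w x) =
      a j k * (MpsiC r w x (fun v => v j * v k) -
        rhoC r w x * (uC r w x j * uC r w x k + if j = k then thetaC r w x else 0)) +
      a j k * (if j = k then rhoC r w x * thetaC r w x else 0) := by
    intro j k
    rw [Mmom_eq_MpsiC, momC_mul_momC_div hρ]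
    split_ifs <;> ring
  have h2 : ∑ j, ∑ k, a j k * (Mmom r w x j k - momC r w x j * momC r w x k / rhoC r w x) =
      (∑ j, ∑ k, a j k * (MpsiC r w x (fun v => v j * v k) -
        rhoC r w x * (uC r w x j * uC r w x k + if j = k then thetaC r w x else 0))) +
      ∑ j, ∑ k, a j k * (if j = k then rhoC r w x * thetaC r w x else 0) := by
    rw [← Finset.sum_add_distrib]
    refine Finset.sum_congr rfl fun j _ => ?_
    rw [← Finset.sum_add_distrib]
    exact Finset.sum_congr rfl fun k _ => h1 j k
  rw [h2, sum_sum_mul_ite, htr, mul_zero, add_zero]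

/-- `|x + y + z| ≤ |x| + |y| + |z|`. [folklore] -/
theorem abs_add_three_le (x y z : ℝ) : |x + y + z| ≤ |x| + |y| + |z| :=
  (abs_add_le _ _).trans (by linarith [abs_add_le x y])

/-- **THE BULK IDENTITY (as an inequality).** Off the empty cone and at positive temperature, for a traceless `a` with
`|a_{jk}| ≤ A` and every cut-off level `L`:
`|Σ a_{jk} P_{jk}| ≤ A Σ_{jk} |err_{jk}| + 9A (|err_E| + 2 MpsiC (sqTail L))`, where
`err_ψ = MpsiC ψ − ρ_r ∫ ψ M_{1,θ_r,u_r}` are pointwise-local-equilibrium errors of bounded continuous tests.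
[folklore] -/
theorem abs_sum_Pm_le_of_bulk
    (hMM : ∀ (ρ θ : ℝ) (u : V3), 0 < ρ → 0 < θ →
      let m : Measure V3 := volume.withDensity (fun v => ENNReal.ofReal (localMaxwellian ρ θ u v))
      IsFiniteMeasure m ∧ Integrable (fun v : V3 => ‖v‖ ^ 2) m ∧
      (m Set.univ).toReal = ρ ∧ (∀ j : Fin 3, ∫ v, v j ∂m = ρ * u j) ∧
      (∀ j k : Fin 3, ∫ v, v j * v k ∂m = ρ * (u j * u k + if j = k then θ else 0)) ∧
      (∫ v, ‖v‖ ^ 2 ∂m = ρ * (‖u‖ ^ 2 + 3 * θ)) ∧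
      (∀ ψ : V3 → ℝ, Continuous ψ → (∃ C : ℝ, ∀ v, |ψ v| ≤ C) →
        Integrable ψ m ∧ ∫ v, ψ v ∂m = ρ * ∫ v, ψ v * localMaxwellian 1 θ u v))
    {r : ℝ} (hr : 0 < r) (w : Phase N) (x : T3) (hρ : rhoC r w x ≠ 0) (hθ : 0 < thetaC r w x)
    (a : Fin 3 → Fin 3 → ℝ) (htr : ∑ j, a j j = 0) {A : ℝ} (hA : ∀ j k, |a j k| ≤ A) (L : ℝ) :
    |∑ j, ∑ k, a j k * (Mmom r w x j k - momC r w x j * momC r w x k / rhoC r w x)| ≤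
      A * ∑ j, ∑ k, |MpsiC r w x (psiJK L j k) -
        rhoC r w x * ∫ v, psiJK L j k v * localMaxwellian 1 (thetaC r w x) (uC r w x) v| +
      9 * A * (|MpsiC r w x (psiE L) - rhoC r w x * ∫ v, psiE L v * localMaxwellian 1 (thetaC r w x) (uC r w x) v| +
        2 * MpsiC r w x (sqTail L)) := by
  set ρ := rhoC r w x with hρdef; set θ := thetaC r w x with hθdef; set u := uC r w x with hudef
  set tl := MpsiC r w x (sqTail L) with htl
  set XE := ∫ v, psiE L v * localMaxwellian 1 θ u v with hXE
  have hρpos : 0 < ρ := lt_of_le_of_ne (rhoC_nonneg hr w x) (Ne.symm hρ)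
  have hA0 : 0 ≤ A := (abs_nonneg _).trans (hA 0 0)
  rw [sum_mul_Pm_eq hρ a htr]
  -- the Maxwellian energy tail is a PLE error plus an empirical tail
  have h3 : ρ * ((‖u‖ ^ 2 + 3 * θ) - XE) ≤ |MpsiC r w x (psiE L) - ρ * XE| + tl := by
    have e := rhoC_mul_norm_uC_sq_add hρ
    have t := two_kinC_sub_MpsiC_psiE_le hr w x L
    rw [mul_sub, e]
    linarith [le_abs_self (MpsiC r w x (psiE L) - ρ * XE)]
  have key : ∀ j k, |MpsiC r w x (fun v => v j * v k) - ρ * (u j * u k + if j = k then θ else 0)| ≤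
      tl + |MpsiC r w x (psiJK L j k) - ρ * ∫ v, psiJK L j k v * localMaxwellian 1 θ u v| +
        (|MpsiC r w x (psiE L) - ρ * XE| + tl) := by
    intro j k
    have h1 := abs_MpsiC_vv_sub_le hr w x L j k
    have h2 := maxwellian_trunc_le hMM hθ u L j k
    set XJ := ∫ v, psiJK L j k v * localMaxwellian 1 θ u v with hXJ
    have hsplit : MpsiC r w x (fun v => v j * v k) - ρ * (u j * u k + if j = k then θ else 0) =
        (MpsiC r w x (fun v => v j * v k) - MpsiC r w x (psiJK L j k)) +
        (MpsiC r w x (psiJK L j k) - ρ * XJ) + ρ * (XJ - (u j * u k + if j = k then θ else 0)) := by ring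
    rw [hsplit]
    refine (abs_add_three_le _ _ _).trans ?_
    have h4 : |ρ * (XJ - (u j * u k + if j = k then θ else 0))| ≤ |MpsiC r w x (psiE L) - ρ * XE| + tl := by
      rw [abs_mul, abs_of_pos hρpos, abs_sub_comm]
      exact (mul_le_mul_of_nonneg_left h2 hρpos.le).trans h3
    linarith
  -- sum over the nine pairs
  calc |∑ j, ∑ k, a j k * (MpsiC r w x (fun v => v j * v k) - ρ * (u j * u k + if j = k then θ else 0))|
      ≤ ∑ j, ∑ k, |a j k| * |MpsiC r w x (fun v => v j * v k) - ρ * (u j * u k + if j = k then θ else 0)| := by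
        refine (Finset.abs_sum_le_sum_abs _ _).trans (Finset.sum_le_sum fun j _ => ?_)
        refine (Finset.abs_sum_le_sum_abs _ _).trans (Finset.sum_le_sum fun k _ => ?_)
        rw [abs_mul]
    _ ≤ ∑ j, ∑ k, A * (tl + |MpsiC r w x (psiJK L j k) - ρ * ∫ v, psiJK L j k v * localMaxwellian 1 θ u v| +
          (|MpsiC r w x (psiE L) - ρ * XE| + tl)) :=
        Finset.sum_le_sum fun j _ => Finset.sum_le_sum fun k _ =>
          mul_le_mul (hA j k) (key j k) (abs_nonneg _) hA0
    _ = A * ∑ j, ∑ k, |MpsiC r w x (psiJK L j k) - ρ * ∫ v, psiJK L j k v * localMaxwellian 1 θ u v| +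
          9 * A * (|MpsiC r w x (psiE L) - ρ * XE| + 2 * tl) := by
        simp only [Fin.sum_univ_three]
        ring

/-! ## §5 The pointwise bound of the stress-isotropy integrand -/

/-- `Σ_{jk} |a_{jk}| |P_{jk}| ≤ 45 A ρ_rθ_r`. [folklore] -/
theorem abs_sum_mul_Pm_le {r : ℝ} (hr : 0 < r) (w : Phase N) (x : T3) (a : Fin 3 → Fin 3 → ℝ) {A : ℝ}
    (hA : ∀ j k, |a j k| ≤ A) :
    |∑ j, ∑ k, a j k * (Mmom r w x j k - momC r w x j * momC r w x k / rhoC r w x)| ≤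
      45 * A * (rhoC r w x * thetaC r w x) := by
  have hA0 : 0 ≤ A := (abs_nonneg _).trans (hA 0 0)
  calc |∑ j, ∑ k, a j k * (Mmom r w x j k - momC r w x j * momC r w x k / rhoC r w x)|
      ≤ ∑ j, ∑ k, |a j k| * |Mmom r w x j k - momC r w x j * momC r w x k / rhoC r w x| := by
        refine (Finset.abs_sum_le_sum_abs _ _).trans (Finset.sum_le_sum fun j _ => ?_)
        refine (Finset.abs_sum_le_sum_abs _ _).trans (Finset.sum_le_sum fun k _ => ?_)
        rw [abs_mul]
    _ ≤ ∑ _j : Fin 3, ∑ _k : Fin 3, A * (5 * (rhoC r w x * thetaC r w x)) :=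
        Finset.sum_le_sum fun j _ => Finset.sum_le_sum fun k _ =>
          mul_le_mul (hA j k) (abs_Pm_le hr w x j k) (abs_nonneg _) hA0
    _ = 45 * A * (rhoC r w x * thetaC r w x) := by
        simp only [Finset.sum_const, Finset.card_univ, Fintype.card_fin, nsmul_eq_mul]
        push_cast
        ring

/-- **THE POINTWISE BOUND OF THE STRESS-ISOTROPY INTEGRAND.** For a configuration `w`, a centre `x`, a traceless
`a` with `|a_{jk}| ≤ A`, `|g(σ³ρ_r)| ≤ G_b`, the bulk weight `h = χ · g(σ³ ·)` (`χ = bulkCut ρ₁ θ₁ Θ U`) and a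
level `M`:
`|g(σ³ρ_r) Σ a_{jk}P_{jk}| ≤ 45 G_b A · Bnd + A Σ_{jk} |h||err_{jk}| + 9A |h||err_E| + 18 A G_b MpsiC (sqTail M)`
with `Bnd` the non-bulk bound of helper B. [folklore] -/
theorem abs_weighted_sum_Pm_le
    (hMM : ∀ (ρ θ : ℝ) (u : V3), 0 < ρ → 0 < θ →
      let m : Measure V3 := volume.withDensity (fun v => ENNReal.ofReal (localMaxwellian ρ θ u v))
      IsFiniteMeasure m ∧ Integrable (fun v : V3 => ‖v‖ ^ 2) m ∧
      (m Set.univ).toReal = ρ ∧ (∀ j : Fin 3, ∫ v, v j ∂m = ρ * u j) ∧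
      (∀ j k : Fin 3, ∫ v, v j * v k ∂m = ρ * (u j * u k + if j = k then θ else 0)) ∧
      (∫ v, ‖v‖ ^ 2 ∂m = ρ * (‖u‖ ^ 2 + 3 * θ)) ∧
      (∀ ψ : V3 → ℝ, Continuous ψ → (∃ C : ℝ, ∀ v, |ψ v| ≤ C) →
        Integrable ψ m ∧ ∫ v, ψ v ∂m = ρ * ∫ v, ψ v * localMaxwellian 1 θ u v))
    {r : ℝ} (hr : 0 < r) (w : Phase N) (x : T3) {σ : ℝ} (g : ℝ → ℝ) {Gb : ℝ} (hGb0 : 0 ≤ Gb)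
    (hg : |g (σ ^ 3 * rhoC r w x)| ≤ Gb) (a : Fin 3 → Fin 3 → ℝ) (htr : ∑ j, a j j = 0) {A : ℝ}
    (hA : ∀ j k, |a j k| ≤ A) {ρ₁ θ₁ Θ U : ℝ} (hρ₁ : 0 < ρ₁) (hθ₁ : 0 < θ₁) (hΘ : 0 < Θ) (hU : 0 < U) (M : ℝ)
    (h : ℝ × V3 × ℝ → ℝ) (hh : ∀ p, h p = bulkCut ρ₁ θ₁ Θ U p * g (σ ^ 3 * p.1)) :
    |g (σ ^ 3 * rhoC r w x) * ∑ j, ∑ k, a j k * (Mmom r w x j k - momC r w x j * momC r w x k / rhoC r w x)| ≤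
      45 * Gb * A * (2 * θ₁ * rhoC r w x + ρ₁ * Θ + (4 * M ^ 2 / (9 * Θ) + 8 * M ^ 2 / (3 * U ^ 2)) * kinC r w x +
        2 / 3 * MpsiC r w x (sqTail M)) +
      A * ∑ j, ∑ k, |h (rhoC r w x, uC r w x, thetaC r w x)| * |MpsiC r w x (psiJK M j k) -
        rhoC r w x * ∫ v, psiJK M j k v * localMaxwellian 1 (thetaC r w x) (uC r w x) v| +
      9 * A * (|h (rhoC r w x, uC r w x, thetaC r w x)| * |MpsiC r w x (psiE M) -
        rhoC r w x * ∫ v, psiE M v * localMaxwellian 1 (thetaC r w x) (uC r w x) v|) +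
      18 * A * Gb * MpsiC r w x (sqTail M) := by
  set p : ℝ × V3 × ℝ := (rhoC r w x, uC r w x, thetaC r w x) with hp
  set χ := bulkCut ρ₁ θ₁ Θ U p with hχ
  set S := ∑ j, ∑ k, a j k * (Mmom r w x j k - momC r w x j * momC r w x k / rhoC r w x) with hS
  set tl := MpsiC r w x (sqTail M) with htl
  set EJ : Fin 3 → Fin 3 → ℝ := fun j k => |MpsiC r w x (psiJK M j k) -
    rhoC r w x * ∫ v, psiJK M j k v * localMaxwellian 1 (thetaC r w x) (uC r w x) v| with hEJ
  set EE := |MpsiC r w x (psiE M) - rhoC r w x * ∫ v, psiE M v * localMaxwellian 1 (thetaC r w x) (uC r w x) v|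
    with hEE
  have hA0 : 0 ≤ A := (abs_nonneg _).trans (hA 0 0)
  have hχ0 : 0 ≤ χ := bulkCut_nonneg ρ₁ θ₁ Θ U p; have hχ1 : χ ≤ 1 := bulkCut_le_one ρ₁ θ₁ Θ U p
  have htl0 : 0 ≤ tl := MpsiC_nonneg hr w x (sqTail_nonneg M)
  have hEJ0 : ∀ j k, 0 ≤ EJ j k := fun j k => abs_nonneg _; have hEE0 : 0 ≤ EE := abs_nonneg _
  have hH : h p = χ * g (σ ^ 3 * rhoC r w x) := hh p
  have hHabs : |h p| = χ * |g (σ ^ 3 * rhoC r w x)| := by rw [hH, abs_mul, abs_of_nonneg hχ0]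
  have hHle : |h p| ≤ Gb := by
    rw [hHabs]
    calc χ * |g (σ ^ 3 * rhoC r w x)| ≤ 1 * Gb := mul_le_mul hχ1 hg (abs_nonneg _) zero_le_one
      _ = Gb := one_mul _
  have hρθ0 := psvK_rhoC_mul_thetaC_nonneg hr w x
  have hS1 : |S| ≤ 45 * A * (rhoC r w x * thetaC r w x) := abs_sum_mul_Pm_le hr w x a hA
  -- split |g S| = (1 - χ)|g||S| + χ|g||S|
  have hsplit : |g (σ ^ 3 * rhoC r w x) * S| =
      (1 - χ) * (|g (σ ^ 3 * rhoC r w x)| * |S|) + |h p| * |S| := by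
    rw [abs_mul, hHabs]; ring
  -- the non-bulk part
  have hnb : (1 - χ) * (|g (σ ^ 3 * rhoC r w x)| * |S|) ≤
      45 * Gb * A * (2 * θ₁ * rhoC r w x + ρ₁ * Θ + (4 * M ^ 2 / (9 * Θ) + 8 * M ^ 2 / (3 * U ^ 2)) * kinC r w x +
        2 / 3 * tl) := by
    have h1 : |g (σ ^ 3 * rhoC r w x)| * |S| ≤ Gb * (45 * A * (rhoC r w x * thetaC r w x)) :=
      mul_le_mul hg hS1 (abs_nonneg _) hGb0
    have h2 := one_sub_bulkCut_mul_le hr w x M hρ₁ hθ₁ hΘ hU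
    rw [← hp, ← hχ] at h2
    have h3 : (1 - χ) * (|g (σ ^ 3 * rhoC r w x)| * |S|) ≤ (1 - χ) * (Gb * (45 * A * (rhoC r w x * thetaC r w x))) :=
      mul_le_mul_of_nonneg_left h1 (sub_nonneg.2 hχ1)
    have h4 : (1 - χ) * (Gb * (45 * A * (rhoC r w x * thetaC r w x))) =
        45 * Gb * A * ((1 - χ) * (rhoC r w x * thetaC r w x)) := by ring
    have h5 : 45 * Gb * A * ((1 - χ) * (rhoC r w x * thetaC r w x)) ≤
        45 * Gb * A * (2 * θ₁ * rhoC r w x + ρ₁ * Θ + (4 * M ^ 2 / (9 * Θ) + 8 * M ^ 2 / (3 * U ^ 2)) * kinC r w x +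
          2 / 3 * tl) := mul_le_mul_of_nonneg_left h2 (by positivity)
    linarith
  -- the bulk part
  have hb : |h p| * |S| ≤ A * ∑ j, ∑ k, |h p| * EJ j k + 9 * A * (|h p| * EE) + 18 * A * Gb * tl := by
    by_cases hχz : χ = 0
    · have h0 : |h p| = 0 := by rw [hHabs, hχz, zero_mul]
      simp only [h0, zero_mul, mul_zero, Finset.sum_const_zero, zero_add]
      positivity
    · -- on the support of χ the state is in the bulk
      have hst : ¬(p.1 ≤ ρ₁ ∨ p.2.2 ≤ θ₁ ∨ Θ ≤ p.2.2 ∨ U ≤ ‖p.2.1‖) := fun hc =>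
        hχz (bulkCut_eq_zero (p := p) hρ₁ hθ₁ hΘ hU hc)
      simp only [not_or, not_le] at hst
      have hρpos : 0 < rhoC r w x := hρ₁.trans hst.1
      have hθpos : 0 < thetaC r w x := hθ₁.trans hst.2.1
      have hbulk := abs_sum_Pm_le_of_bulk hMM hr w x hρpos.ne' hθpos a htr hA M
      rw [← hS] at hbulk
      have h1 : |h p| * |S| ≤ |h p| * (A * ∑ j, ∑ k, EJ j k + 9 * A * (EE + 2 * tl)) :=
        mul_le_mul_of_nonneg_left hbulk (abs_nonneg _)
      have h2' : ∑ j, ∑ k, |h p| * EJ j k = |h p| * ∑ j, ∑ k, EJ j k := by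
        rw [Finset.mul_sum]
        refine Finset.sum_congr rfl fun j _ => ?_
        rw [Finset.mul_sum]
      have h2 : |h p| * (A * ∑ j, ∑ k, EJ j k + 9 * A * (EE + 2 * tl)) =
          A * ∑ j, ∑ k, |h p| * EJ j k + 9 * A * (|h p| * EE) + 18 * A * (|h p| * tl) := by
        rw [h2']
        ring
      have h3 : 18 * A * (|h p| * tl) ≤ 18 * A * Gb * tl := by
        have := mul_le_mul_of_nonneg_right hHle htl0
        nlinarith
      linarith
  rw [hsplit]
  linarith

/-! ## §6 Registered sub-goal -/

/-- **Registered sub-goal `stub_stressIsotropyTrace` (helper C of `stub_stressIsotropyOfLocalEquilibrium`): contraction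
of a matrix with the identity is the trace** — `Σ_{jk} a_{jk} (c δ_{jk}) = c tr a`, the step where tracelessness of
the test removes the pressure `ρ_rθ_r` from the stress contraction. [folklore] -/
theorem stub_stressIsotropyTrace : ∀ (a : Fin 3 → Fin 3 → ℝ) (c : ℝ), ∑ j, ∑ k, a j k * (if j = k then c else 0) = c * ∑ j, a j j :=
  fun a c => sum_sum_mul_ite a c

end Summit.AtomisticToContinuum.HydrodynamicLimit.Theorems.ChaosClosesEulerStressIsotropy

end
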